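import Literature.AlgebraicGeometry.Hu2025.Statements.S03Pluecker.R101aPlatform
import Mathlib.LinearAlgebra.Matrix.Determinant.Basic
import Mathlib.LinearAlgebra.Matrix.Notation
import Mathlib.RingTheory.Ideal.Quotient.Operations
import Mathlib.RingTheory.Adjoin.Basic
import HarnessLib

/-!
# Hu 2025 (arXiv:2507.21400v1) §3.2–§3.3 = PDF §3b–§3c, chunks p0017 l.64 – p0019 l.62 (PDF p.35 l.37 – p.40 l.60) — row 101b: Prop 3.6 (the chart
# `𝕌 ∩ Gr^{3,E}` is the affine space on `Var_𝕌`), Prop 3.8, the in-text claims «|𝕀^lt_{3,n}| = Υ» (C17L64),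
# «𝕀^lt ↔ 𝓕_m is a bijection» (C18L15), «every F̄_{h,k} is a polynomial in the F̄_{m,u}» (C18L166), the (keyTrick) recipe
# AS PRINTED with its `_ours` sibling, Ex 3.2, Rem 3.10
# STATEMENTS-FIRST typing (rung M-Hu-min of LADDER-RESOLUTION, D-0089); imports the row-101a platform

**Status of the source (D-0012): UNREFEREED PREPRINT UNDER ADJUDICATION** ([Hu2025], lit key `paper:arxiv-2507.21400`, TeX
chunks of record; «PDF p.N l.a–b» read on `lit/res-lit-6/hu25/text/hu25_pNNN.txt`, PDF display numbers (3.k) given next to the TeX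
labels). Nothing is asserted: claims are `def … : Prop` candidates `[claim: Hu2025, status: under-review]`; the two
auxiliary objects of this file (`BasicRing`, `chartParam`) are real definitions. No proofs, no `sorry`, no `instance`.

## Reading notes (what is printed, what is typed; no view taken — README §3 T10)
* **Prop 3.6** (chunk p0018 l.75–88; PDF p.38 l.11–19) has two sentences. (2) «the chart 𝕌_Gr = 𝕌 ∩ Gr^{3,E} comes equipped with the set
  of free variables Var_𝕌 … and is canonically isomorphic to the affine space with the above variables as its local free
  variables» is typed at the ring level as `Prop3_6_2`: the composite `k[Var_𝕌] → k[x_u] → k[x_u]/(𝓕)` is an isomorphism of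
  `k`-algebras (proof text l.96–131 = PDF p.38 l.22 – p.39 l.11: each `F̄_{(123),u}` «is equivalent to an expression of the leading variable x_u as a
  polynomial in the free variables of Var_𝕌»). (1) «The affine subspace 𝕌_Gr = 𝕌 ∩ Gr^{3,E} embedded in the affine space 𝕌
  is defined by the relations in 𝓕» needs the chart `𝕌 ∩ Gr^{3,E}` itself. RING-LEVEL READING used here (`Prop3_6_1`): by the
  Plücker embedding `F ↦ [∧³F]`, `∧³E = ⊕ E_{i₁} ⊗ E_{i₂} ⊗ E_{i₃}` (chunk p0016 l.54–63 = PDF p.33 l.6–13), `p_u(F)` is the `u`-th `3 × 3`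
  minor of a basis matrix of `F`, and on `p₁₂₃ ≠ 0` the basis can be normalised to the rows of `[I₃ | A]`; so the ideal of
  `𝕌 ∩ Gr^{3,E}` in `k[x_u]` is the kernel of `chartParam : x_u ↦ det([I₃ | A] columns u)`, `A` the universal `3 × (n−3)`
  matrix whose entries are, by that same formula at `u = (12a), (13a), (23a)`, the basic variables `A_{3a} = x_{12a}`,
  `A_{2a} = −x_{13a}`, `A_{1a} = x_{23a}` — the convention of the tree certificate `Hu2025/GammaSchemeNotIntegral.lean`
  («a point is a 3 × 9 matrix [I₃ | A] … p_{ijk} = det(a_i, a_j, a_k)»). Sentence (1) then reads `ker chartParam = (𝓕_m)`.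
  The SCHEME-level sentence over the tree Grassmannian `Motives.FanoPlanes.grassmannian 2 (n-1) k` is row 110's.
* **C18L166** (chunk p0018 l.164–171; PDF p.39 l.30–34: «according to Proposition 3.6, every de-homogenized Plücker equation F̄_{h,k} on the
  chart 𝕌 can be expressed as a polynomial in the de-homogenized primary Plücker relations F̄_{m,u} with u ∈ 𝕀^lt_{3,n}»):
  the paper's own illustration Ex 3.9 (p0019 l.14–20 = PDF p.40 l.7–9, for `Gr(2,5)`: «p₄₅ F₁ = p₃₄ F₃ − p₂₄ F₄ + p₁₄ F₅») is a combination
  with POLYNOMIAL COEFFICIENTS, i.e. ideal membership — typed as `C18L166` (`I_{℘,m} ≤ (𝓕_m)`); the literal phrase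
  («a polynomial in the F̄_{m,u}», subalgebra membership) is the sibling reading `C18L166_R2`.
* **(keyTrick1)–(keyTrick4)** = PDF (3.6)–(3.8) (chunk p0017 l.79–114; PDF p.36 l.7–32): «take any element u = (u₁u₂u₃) ∈ 𝕀^lt_{3,n}. We then set
  h = (u₂u₃) and k = (u123). This gives rise to the Plücker relation F_{h,k}» =: `F_{m,u}` (printed «k = (u123)», chunk l.85 = PDF p.36
  l.9, read `k = (u₁123)` as (keyTrick2) `p_{(u∖u₁)u₁} p_m + Σ_i (−1)^i p_{(u∖u₁)i} p_{u₁(m∖{i})}` and the expansion (3.6) force), and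
  (l.116–117 = PDF p.36 l.33) «More
  concretely, all of the equations in (keyTrick4) [PDF: (3.8)] are of the following forms» (the four explicit forms = row 101a's
  `primaryRel`). Typed AS PRINTED (`keyTrickRel`, claim `C17L116`) — `-- sic`: with `u₁` the least element of `u`
  (p0016 l.32–36 = PDF p.32 l.25–26 writes `u = (u₁u₂u₃)` increasingly), `k = (u₁123)` has a repeated index whenever `u₁ ∈ {1,2,3}`, so
  `F_{h,k}` vanishes identically for `u = (1uv), (2uv), (3uv)` by the convention p0016 l.98–105 = PDF (3.2), while the explicit forms
  do not. `_ours` sibling (`keyTrickRel_ours`, `C17L116_ours`): remove from `u` an element NOT in `m` — the recipe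
  `h = (u₁u₂)`, `k = (u₃123)` for `u₁ ∈ m` and the printed `h = (u₂u₃)`, `k = (u₁123)` for `u₁ ∉ m` reproduces the four
  explicit forms with their printed signs (hand expansion by the typer; Rem 3.10 l.59 = PDF p.40 l.59 confirms the rank-1 choice «The one
  we used in this paper is F_{m,(abc,a)}»). Both are indexed; the adjudication reads both.
* **Ex 3.9** (chunk p0019 l.4–37 = PDF p.40 l.3–47) concerns `Gr(2,5)` (2-planes, five 3-term relations) — outside the `Gr^{3,E}` platform of
  this paper's §3 ff.; NOT typed (index only). **Rem 3.10** is typed by its last sentence only (`Rem3_10`).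
-/

noncomputable section

namespace Literature.AlgebraicGeometry.Hu2025.Statements.S03Pluecker

open MvPolynomial

universe v

/-! ## §3.2–§3.3 in-text claims, chunk p0017 l.64–68 (PDF p.35 l.37–46) and p0018 l.9–15 (PDF p.37 l.26–29) -/

/-- **Unnumbered claim C17L64** (chunk p0017 l.64–68; PDF p.35 l.37–46): «Then, one calculates and finds |𝕀^lt_{3,n}| = Υ = C(n,3) − 1 −
3(n−3), where |𝕀^lt_{3,n}| denotes the cardinality of 𝕀^lt_{3,n}» (under the standing `n > 3`).
[claim: Hu2025, status: under-review]
STATUS: candidate statement under adjudication (D-0012/D-0089); not asserted. -/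
def C17L64 (n : ℕ) : Prop :=
  HuPlatform n → Nat.card {u : plIndex n // IsLt u.1} = Upsilon n

/-- **Unnumbered claim C18L15** (chunk p0018 l.11–15; PDF p.37 l.26–29): «we have the correspondence 𝕀^lt_{3,n} ⟷ 𝓕_m, u → F_{m,u}.
Obviously, this is a bijection» — onto `𝓕_m` by definition (`primaryFamily`); typed content: `u ↦ F̄_{m,u}` is injective on
`𝕀^lt_{3,n}` (over a nontrivial base ring). [claim: Hu2025, status: under-review]
STATUS: candidate statement under adjudication (D-0012/D-0089); not asserted. -/
def C18L15 (n : ℕ) (k : Type v) [CommRing k] : Prop :=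
  Nontrivial k → Set.InjOn (fun u : plIndex n => primaryRelBar n k u.1) {u | IsLt u.1}

/-! ## Prop 3.6, chunk p0018 l.75–134 (PDF p.38 l.11 – p.39 l.13): `𝕌 ∩ Gr^{3,E}` is the affine space on `Var_𝕌` -/

/-- **The polynomial ring `k[Var_𝕌]` on the m-basic variables** (Prop 3.6, chunk p0018 l.82–88 = PDF p.38 l.15–19 «the affine space
with the above variables as its local free variables»; proof l.129–131 = PDF p.39 l.10–11 «the affine space of dimension 3(n−3) with the variables of
Var_𝕌 as its local free variables»). Auxiliary carrier. [claim: Hu2025, status: under-review]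
STATUS: candidate statement under adjudication (D-0012/D-0089); not asserted. -/
abbrev BasicRing (n : ℕ) (k : Type v) [CommRing k] : Type v := MvPolynomial {x : plVar n // IsBasic x} k

/-- The inclusion of variables `Var_𝕌 ⊆ {x_u : u ∈ 𝕀_{3,n} ∖ m}` as the `k`-algebra map `k[Var_𝕌] → k[x_u]` (Prop 3.6 proof,
chunk p0018 l.125–131 = PDF p.39 l.8–11). Auxiliary. [claim: Hu2025, status: under-review]
STATUS: candidate statement under adjudication (D-0012/D-0089); not asserted. -/
def basicIncl (n : ℕ) (k : Type v) [CommRing k] : BasicRing n k →ₐ[k] ChartRing n k :=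
  rename fun x : {x : plVar n // IsBasic x} => x.1

/-- **The basic variable `x_t` as an element of `k[Var_𝕌]`** (`0` unless `t ∈ 𝕀_{3,n} ∖ m ∖ 𝕀^lt`, junk). Auxiliary lookup.
[claim: Hu2025, status: under-review]
STATUS: candidate statement under adjudication (D-0012/D-0089); not asserted. -/
def bvar {n : ℕ} (k : Type v) [CommRing k] (t : ℕ × ℕ × ℕ) : BasicRing n k :=
  if h : t ∈ plVarSet n ∧ ¬ IsLt t then X ⟨⟨t, h.1⟩, h.2⟩ else 0

/-- **The columns of the universal chart matrix `[I₃ | A]`** (RING-LEVEL READING of `𝕌 ∩ Gr^{3,E}`, see the module docstring;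
Plücker embedding chunk p0016 l.54–63 = PDF p.33 l.6–13, chart p0017 l.18–26 = PDF p.35 l.8–10): column `j ≤ 3` is the `j`-th unit vector, column `a > 3` is
`(A_{1a}, A_{2a}, A_{3a}) = (x_{23a}, −x_{13a}, x_{12a})` so that `det([I₃|A] columns (12a), (13a), (23a)) = x_{12a}, x_{13a},
x_{23a}` (the convention «p_{ijk} = det(a_i, a_j, a_k)» of the tree certificate `Hu2025/GammaSchemeNotIntegral.lean`).
Auxiliary. [claim: Hu2025, status: under-review]
STATUS: candidate statement under adjudication (D-0012/D-0089); not asserted. -/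
def chartCol {n : ℕ} (k : Type v) [CommRing k] (a : ℕ) : Fin 3 → BasicRing n k :=
  if a = 1 then ![1, 0, 0] else if a = 2 then ![0, 1, 0] else if a = 3 then ![0, 0, 1]
  else ![bvar k (2, 3, a), -bvar k (1, 3, a), bvar k (1, 2, a)]

/-- **The `u`-th `3 × 3` minor of `[I₃ | A]`**, `u = (u₁, u₂, u₃)`: the determinant of the matrix whose ROWS are the columns
`u₁, u₂, u₃` (`det Mᵀ = det M`). This is `p_u` of the 3-plane spanned by the rows of `[I₃ | A]` under `F ↦ [∧³F]` (chunk
p0016 l.54–63 = PDF p.33 l.11–13), normalised by `p₁₂₃ = 1`. Auxiliary (RING-LEVEL READING, module docstring). [claim: Hu2025, status: under-review]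
STATUS: candidate statement under adjudication (D-0012/D-0089); not asserted. -/
def chartMinor {n : ℕ} (k : Type v) [CommRing k] (u : ℕ × ℕ × ℕ) : BasicRing n k :=
  Matrix.det (Matrix.of ![chartCol k u.1, chartCol k u.2.1, chartCol k u.2.2])

/-- **Evaluation of the chart coordinates on the universal point `[I₃ | A]`**: the `k`-algebra map `k[x_u] → k[Var_𝕌]`,
`x_u ↦ det([I₃ | A] columns u)` (RING-LEVEL READING of «𝕌 ∩ Gr^{3,E} ⊂ 𝕌», module docstring). On the basic variables it is
the identity (`x_{12a} ↦ x_{12a}` etc.). Auxiliary. [claim: Hu2025, status: under-review]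
STATUS: candidate statement under adjudication (D-0012/D-0089); not asserted. -/
def chartParam (n : ℕ) (k : Type v) [CommRing k] : ChartRing n k →ₐ[k] BasicRing n k :=
  aeval fun x : plVar n => chartMinor k x.1

/-- **Proposition 3.6, first sentence** (chunk p0018 l.75–80; PDF p.38 l.11–14): «The affine subspace 𝕌_Gr = 𝕌 ∩ Gr^{3,E} embedded in the
affine space 𝕌 is defined by the relations in 𝓕 = {F̄_{(123),u} ∣ u ∈ 𝕀^{(123)}_{3,n}}» — RING-LEVEL READING (module
docstring): the ideal of `k[x_u]` of all polynomials vanishing on the universal point `[I₃ | A]` of the chart, `ker chartParam`,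
is the ideal generated by `𝓕_m`. (Proof text l.125–132 = PDF p.39 l.8–12: «Let J be the ideal … generated by {F̄_{(123),u}} … Since 𝕌_Gr ⊂
V(J), we conclude 𝕌_Gr = V(J).») Under the standing `n > 3`. [claim: Hu2025, status: under-review]
STATUS: candidate statement under adjudication (D-0012/D-0089); not asserted. -/
def Prop3_6_1 (n : ℕ) (k : Type v) [CommRing k] : Prop :=
  HuPlatform n → RingHom.ker (chartParam n k).toRingHom = Ideal.span (primaryFamily n k)

/-- **Proposition 3.6, second sentence** (chunk p0018 l.82–88; PDF p.38 l.15–19): «Consequently, the chart 𝕌_Gr = 𝕌 ∩ Gr^{3,E} comes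
equipped with the set of free variables Var_𝕌 := {x_u ∣ u ∈ 𝕀_{3,n} ∖ {(123)} ∖ 𝕀^{(123)}_{3,n}} and is canonically
isomorphic to the affine space with the above variables as its local free variables» — typed: the composite
`k[Var_𝕌] → k[x_u] → k[x_u]/(𝓕_m)` is bijective (an isomorphism of `k`-algebras; proof l.96–123 = PDF p.38 l.22 – p.39 l.7: every `F̄_{(123),u}` «is
equivalent to an expression of the leading variable x_u as a polynomial in the free variables of Var_𝕌»). Under `n > 3`.
[claim: Hu2025, status: under-review]
STATUS: candidate statement under adjudication (D-0012/D-0089); not asserted. -/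
def Prop3_6_2 (n : ℕ) (k : Type v) [CommRing k] : Prop :=
  HuPlatform n →
    Function.Bijective ((Ideal.Quotient.mkₐ k (Ideal.span (primaryFamily n k))).comp (basicIncl n k))

/-- **Proposition 3.6** (chunk p0018 l.75–88; PDF p.38 l.11–19) = both sentences, `Prop3_6_1 ∧ Prop3_6_2` (see those decls for the
verbatim text and the reading). [claim: Hu2025, status: under-review]
STATUS: candidate statement under adjudication (D-0012/D-0089); not asserted. -/
def Prop3_6 (n : ℕ) (k : Type v) [CommRing k] : Prop := Prop3_6_1 n k ∧ Prop3_6_2 n k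

/-- **Unnumbered claim C18L166** (chunk p0018 l.164–171; PDF p.39 l.30–34): «Fix the chart (p_m ≡ 1). In 𝕜[x_u], according to Proposition
3.6, every de-homogenized Plücker equation F̄_{h,k} on the chart 𝕌 can be expressed as a polynomial in the de-homogenized
primary Plücker relations F̄_{m,u} with u ∈ 𝕀^lt_{3,n}» — IDEAL READING (per the paper's illustration Ex 3.9, p0019 l.14–20 = PDF p.40
l.7–9, a combination with polynomial coefficients): `I_{℘,m} ⊆ (𝓕_m)`. Literal reading: `C18L166_R2`.
[claim: Hu2025, status: under-review]
STATUS: candidate statement under adjudication (D-0012/D-0089); not asserted. -/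
def C18L166 (n : ℕ) (k : Type v) [CommRing k] : Prop :=
  HuPlatform n → IPlChart n k ≤ Ideal.span (primaryFamily n k)

/-- **C18L166, literal reading (R2)**: every de-homogenised Plücker relation `F̄_{h,k} = dehomog(F_{h,k})`, `(h,k) ∈ 𝕀_{2,n} ×
𝕀_{4,n}`, lies in the `k`-SUBALGEBRA of `k[x_u]` generated by `𝓕_m` («expressed as a polynomial in the … F̄_{m,u}», chunk
p0018 l.168–171 = PDF p.39 l.31–34, read literally). [claim: Hu2025, status: under-review]
STATUS: candidate statement under adjudication (D-0012/D-0089); not asserted. -/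
def C18L166_R2 (n : ℕ) (k : Type v) [CommRing k] : Prop :=
  HuPlatform n → ∀ h₁ h₂ k₁ k₂ k₃ k₄ : ℕ, 1 ≤ h₁ → h₁ < h₂ → h₂ ≤ n → 1 ≤ k₁ → k₁ < k₂ → k₂ < k₃ → k₃ < k₄ → k₄ ≤ n →
    dehomog n k (plRel k h₁ h₂ k₁ k₂ k₃ k₄) ∈ Algebra.adjoin k (primaryFamily n k)

/-! ## Prop 3.8, chunk p0018 l.153–162 (PDF p.39 l.24–29) (`rkPrimary`, `𝓕^r` are row 101a's) -/

/-- **Proposition 3.8** (chunk p0018 l.155–162; PDF p.39 l.25–29): «Fix any r = 0 or 1 and any u ∈ 𝕀^lt_{3,n} with rank_m(F_{m,u}) = r.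
Then, the leading variable x_u of F̄_{m,u} does not appear in any relation in 𝓕^{r−1} ∪ (𝓕^r_m ∖ F̄_{m,u}) where we set
𝓕^{−1} = ∅ for the case of r = 0.» Typed: for `u' ∈ 𝕀^lt`, `u' ≠ u`, `rank(F_{m,u'}) ≤ rank(F_{m,u})`, the variable `x_u` is
not among the variables (`MvPolynomial.vars`) of `F̄_{m,u'}`. [claim: Hu2025, status: under-review]
STATUS: candidate statement under adjudication (D-0012/D-0089); not asserted. -/
def Prop3_8 (n : ℕ) (k : Type v) [CommRing k] : Prop :=
  ∀ u u' : plIndex n, IsLt u.1 → IsLt u'.1 → u' ≠ u → rkPrimary u'.1 ≤ rkPrimary u.1 →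
    ∀ x : plVar n, x.1 = u.1 → x ∉ (primaryRelBar n k u'.1).vars

/-! ## (keyTrick1)–(keyTrick4) = PDF (3.6)–(3.8), chunk p0017 l.79–130 (PDF p.36 l.7–38): the compact recipe AS PRINTED
and its `_ours` sibling -/

/-- **`F_{m,u}` by the recipe (keyTrick1) = PDF eq. (3.6), AS PRINTED** (chunk p0017 l.79–93; PDF p.36 l.7–13): «take any element u = (u₁u₂u₃) ∈
𝕀^lt_{3,n}. We then set h = (u₂u₃) and k = (u123). This gives rise to the Plücker relation F_{h,k} = p_{u₂u₃u₁} p₁₂₃ −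
p_{u₂u₃1} p_{u₁23} + p_{u₂u₃2} p_{u₁13} − p_{u₂u₃3} p_{u₂12}» — typed as row 101a's `plRel` at `h = (u₂, u₃)`,
`k = (u₁, 1, 2, 3)` (the last printed factor «p_{u₂12}», chunk l.92 and PDF (3.6) alike, differs from (pluckerEq)'s = (3.3)'s `p_{k₁k₂k₃} =
p_{u₁12}`; (pluckerEq) is used; the printed «k = (u123)» is read `k = (u₁123)`, as (keyTrick2) and the expansion force). `-- sic`: for `u₁ ∈ {1,2,3}` (the forms `(1uv), (2uv), (3uv)`) the index sequence `k = (u₁123)` repeats `u₁`, and this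
expression is identically `0` — see `keyTrickRel_ours` and the module docstring. [claim: Hu2025, status: under-review]
STATUS: candidate statement under adjudication (D-0012/D-0089); not asserted. -/
def keyTrickRel (n : ℕ) (k : Type v) [CommRing k] (u : ℕ × ℕ × ℕ) : PlRing n k :=
  plRel k u.2.1 u.2.2 u.1 1 2 3  -- sic (see docstring)

/-- **`F_{m,u}` by the recipe (keyTrick1), OURS** (evident correction, README §3 T5): remove from `u` an element outside
`m = (123)` — `h = (u₁u₂)`, `k = (u₃123)` when `u₁ ∈ m`, and the printed `h = (u₂u₃)`, `k = (u₁123)` when `u₁ ∉ m`. Hand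
expansion with (signConvention) = (3.1) gives EXACTLY the four explicit forms p0017 l.116–130 = PDF p.36 l.34–37 (e.g. `u = (1uv)`:
`F_{(1u),(v123)} = p_{1uv}p₁₂₃ − 0 + p_{1u2}p_{v13} − p_{1u3}p_{v12} = p₁₂₃p_{1uv} − p_{12u}p_{13v} + p_{13u}p_{12v}`).
Labelled OURS; not attributed to the preprint. [claim: Hu2025, status: under-review]
STATUS: candidate statement under adjudication (D-0012/D-0089); not asserted. -/
def keyTrickRel_ours (n : ℕ) (k : Type v) [CommRing k] (u : ℕ × ℕ × ℕ) : PlRing n k :=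
  if u.1 ∈ mSet then plRel k u.1 u.2.1 u.2.2 1 2 3 else plRel k u.2.1 u.2.2 u.1 1 2 3

/-- **Unnumbered claim C17L116, AS PRINTED** (chunk p0017 l.116–117; PDF p.36 l.33): «More concretely, all of the equations
in (keyTrick4) [PDF: (3.8)] are of the following forms: [the four explicit forms]» — typed: for every `u ∈ 𝕀^lt_{3,n}` the (keyTrick1)
expression `keyTrickRel u` equals the explicit form `primaryRel u` (row 101a). `-- sic` (see `keyTrickRel`): indexed for the
record together with `C17L116_ours`. [claim: Hu2025, status: under-review]
STATUS: candidate statement under adjudication (D-0012/D-0089); not asserted. -/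
def C17L116 (n : ℕ) (k : Type v) [CommRing k] : Prop :=
  ∀ u : plIndex n, IsLt u.1 → keyTrickRel n k u.1 = primaryRel n k u.1  -- sic

/-- **C17L116, OURS**: with the corrected recipe `keyTrickRel_ours`, every `u ∈ 𝕀^lt_{3,n}` gives exactly the explicit form
`primaryRel u` (signs included). [claim: Hu2025, status: under-review]
STATUS: candidate statement under adjudication (D-0012/D-0089); not asserted. -/
def C17L116_ours (n : ℕ) (k : Type v) [CommRing k] : Prop :=
  ∀ u : plIndex n, IsLt u.1 → keyTrickRel_ours n k u.1 = primaryRel n k u.1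

/-! ## Example 3.2 and Remark 3.10 (optional items), chunk p0016 l.144–153 (PDF p.34 l.23–27) and p0019 l.39–61 (PDF p.40 l.48–60) -/

/-- **Example 3.2** (chunk p0016 l.144–153; PDF p.34 l.23–27): «Consider the Grassmannian Gr(3,6). Then, the Plücker relation
F_{(16),(3456)}: p₁₆₃p₄₅₆ − p₁₆₄p₃₅₆ + p₁₆₅p₃₄₆ is of rank zero; the Plücker relation F_{(12),(3456)}: p₁₂₃p₄₅₆ − p₁₂₄p₃₅₆ +
p₁₂₅p₃₄₆ − p₁₂₆p₃₄₅ is of rank one.» Typed on the rank function `rkF` of Def 3.1. [claim: Hu2025, status: under-review]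
STATUS: candidate statement under adjudication (D-0012/D-0089); not asserted. -/
def Ex3_2 : Prop := rkF 1 6 3 4 5 6 = 0 ∧ rkF 1 2 3 4 5 6 = 1

/-- **Remark 3.10, last sentence** (chunk p0019 l.39–61; PDF p.40 l.48–60): for `m = (123)` and `u = (abc)`, `a < b < c ∉ {1,2,3}`, several
Plücker relations contain the term `p_m p_u` — «F_{m,(abc,a)} = p_m p_{abc} − p_{12a}p_{3bc} + p_{13a}p_{2bc} − p_{23a}p_{1bc}»,
`F_{m,(abc,b)}`, `F_{m,(abc,c)}`, `F_{(12),(3abc)}`, `F_{(13),(2abc)}`, `F_{(23),(1abc)}` — and «The one we used in this paper is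
F_{m,(abc,a)}». Typed: for every rank-1 index `u = (a,b,c)` with `3 < a`, the primary relation `F_{m,u}` of Def 3.3 is
`F_{(bc),(a123)}` (the (keyTrick1) relation removing `a`). [claim: Hu2025, status: under-review]
STATUS: candidate statement under adjudication (D-0012/D-0089); not asserted. -/
def Rem3_10 (n : ℕ) (k : Type v) [CommRing k] : Prop :=
  ∀ u : plIndex n, 3 < u.1.1 → primaryRel n k u.1 = plRel k u.1.2.1 u.1.2.2 u.1.1 1 2 3

end Literature.AlgebraicGeometry.Hu2025.Statements.S03Pluecker

end
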